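import Mathlib
import HarnessLib
import HarnessLib.Audit
import Summits.BirchSwinnertonDyer.Statement
import Literature.NumberTheory.EllipticCurves.PAdicLFunction
import Literature.NumberTheory.EllipticCurves.GlobalMinimalModelProofs
import Literature.NumberTheory.EllipticCurves.MinimalModelReduction
import Literature.NumberTheory.EllipticCurves.VariableChangePoints
import Literature.NumberTheory.DiophantineGeometry.LocalReductionProofs
import Literature.NumberTheory.DiophantineGeometry.MinimalModelUniquenessProofs
import Summits.BirchSwinnertonDyer.BirchSwinnertonDyer.Theorems.PAdicOrderExistsOrdinary
import Literature.NumberTheory.EllipticCurves.PAdicBSD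

/-! Probe: the tenure-kit signatures elaborate under EXACTLY the route file's import block and opens
(copied from Theses/PAdicOrderV2.lean rev 10), in a sibling namespace. -/

namespace Summit.BirchSwinnertonDyer.BirchSwinnertonDyer.Theses.PAdicOrderV2Probe

open scoped BigOperators Topology Manifold Classical MeasureTheory ProbabilityTheory Matrix InnerProductSpace ComplexConjugate ContinuousMap
open Filter Set Function TopologicalSpace MeasureTheory

open Literature

/-- copy of crux #2 (route decl), so that the glue signature below can be probed verbatim -/
def PAdicOrderComparisonR2 : Prop :=
  ∀ (W : WeierstrassCurve ℚ) [W.IsElliptic] [W.IsGloballyMinimal] (p : ℕ) [Fact p.Prime], Literature.NumberTheory.EllipticCurves.IsOrdinaryAt W p → ∀ {N : ℕ} [NeZero N] (f : CuspForm (CongruenceSubgroup.Gamma0 N) 2), Literature.NumberTheory.EllipticCurves.ModularForms.IsNewformOf W f → (Literature.NumberTheory.EllipticCurves.padicLFunction f (Literature.NumberTheory.EllipticCurves.unitRoot W p : ℚ_[p])).order = W.analyticRank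

/-- copy of the thesis node X (route decl) -/
def PAdicOrderThesisR2 : Prop :=
  ∀ (W : WeierstrassCurve ℚ) [W.IsElliptic] [W.IsGloballyMinimal], ∃ (p : ℕ) (_ : Fact p.Prime), Literature.NumberTheory.EllipticCurves.IsOrdinaryAt W p ∧ ∃ (N : ℕ) (_ : NeZero N) (f : CuspForm (CongruenceSubgroup.Gamma0 N) 2), Literature.NumberTheory.EllipticCurves.ModularForms.IsNewformOf W f ∧ (Literature.NumberTheory.EllipticCurves.padicLFunction f (Literature.NumberTheory.EllipticCurves.unitRoot W p : ℚ_[p])).order = W.analyticRank ∧ (Literature.NumberTheory.EllipticCurves.padicLFunction f (Literature.NumberTheory.EllipticCurves.unitRoot W p : ℚ_[p])).order = W.mordellWeilRank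

/-- TENURE-KIT signature 1 (new crux, the thesis-faithful rank clause) — ONE LINE, fully qualified. -/
def PAdicOrderRankClauseAtOnePrime : Prop :=
  ∀ (W : WeierstrassCurve ℚ) [W.IsElliptic] [W.IsGloballyMinimal], ∃ (p : ℕ) (_ : Fact p.Prime), Literature.NumberTheory.EllipticCurves.IsOrdinaryAt W p ∧ ∃ (N : ℕ) (_ : NeZero N) (f : CuspForm (CongruenceSubgroup.Gamma0 N) 2), Literature.NumberTheory.EllipticCurves.ModularForms.IsNewformOf W f ∧ (Literature.NumberTheory.EllipticCurves.padicLFunction f (Literature.NumberTheory.EllipticCurves.unitRoot W p : ℚ_[p])).order = W.mordellWeilRank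

/-- TENURE-KIT signature 2 (new support glue, provable now). -/
def CruxesToThesisV4 : Prop :=
  PAdicOrderComparisonR2 → PAdicOrderRankClauseAtOnePrime → PAdicOrderThesisR2

/-- the glue is provable now (3 lines; this is the Theorems proof a prover lands with --workitem <glue item>) -/
theorem cruxesToThesisV4_holds : CruxesToThesisV4 := by
  intro h2 h3 W _ _
  obtain ⟨p, hp, hord, N, hN, f, hf, hrk⟩ := h3 W
  exact ⟨p, hp, hord, N, hN, f, hf, h2 W p hord f hf, hrk⟩

/-- and X still implies the clause (necessity) -/
theorem rankClause_of_thesis (hX : PAdicOrderThesisR2) : PAdicOrderRankClauseAtOnePrime := by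
  intro W _ _
  obtain ⟨p, hp, hord, N, hN, f, hf, -, hrk⟩ := hX W
  exact ⟨p, hp, hord, N, hN, f, hf, hrk⟩

end Summit.BirchSwinnertonDyer.BirchSwinnertonDyer.Theses.PAdicOrderV2Probe
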